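import Summits.Ventures.CertifiedQuantumChemistry.Rows.CharacterSectorRows
import Summits.Ventures.CertifiedQuantumChemistry.Rows.LevelShiftGapRows
import Literature.MathematicalPhysics.QuantumChemistry.SectorEnergyPerturbationBounds
import HarnessLib

/-!
# Rows/CharacterSectorLowerRows.lean: CLASS-SPECIFIC lower rows from a codimension-one form bound with a
# class-pure witness — the missing side of the irrep-gap bracket of `Rows/CharacterSectorRows.lean`

HONEST FRAMING (verbatim): certified bounds for a stated model Hamiltonian in a stated basis; not a claim about
the real molecule or material beyond that model.

LADDER-CHEM I-TYPE (cell chem-oracle, seat chem-type-06 gens 4–5, offer (G3), chem-lead A13 GO 2026-08-27; SIBLING of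
`Rows/CharacterSectorRows` (p470201), whose `CharUpperRow.gap_le` certifies only ONE side of an irrep excitation such as `HC(O)O• ²B₂ − ²A₁`
and says the other side "needs an excited-state instrument"). The instrument is a codimension-one form bound in
the sector — `β · ⟨x, x⟩ ≤ Re ⟨x, H_F x⟩` for every `(a, b)`-sector vector `x` orthogonal to ONE fixed vector `v`
(the hypothesis shape of `gapCertificateCodimOne_of_forall_orthogonal`, produced e.g. by the level-shift
deflation of door M1 with `v = |D⋆⟩` a single determinant) — together with the observation that DISTINCT
CHARACTER CLASSES ARE ORTHOGONAL (disjoint determinant supports, Mazziotti (2007) §II.F eq. (95): the blocks of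
different irreducible representations do not mix). If `v` is class-pure, every vector of every OTHER class is
orthogonal to it, so `β` bounds the class energy `E(H_F; a, b, class p′)` from BELOW for all `p′ ≠ class(v)`:
* `star_dotProduct_eq_zero_of_mem_charSector` — orthogonality of distinct classes;
* `charLowerRow_of_forall_orthogonal` (+ `_single` for `v = c|D⟩`) — the class lower row `CharLowerRow F a b σ p′ β`;
* `charLowerRow_of_lowerRow_shift` — the same fed by level-shift data: symmetric `F`, `S`, `0 ≤ λ`, a class-pure
  `v` with `Re⟨x, Ĥ(S)x⟩ ≤ c‖x‖²` on the sector vectors `x ⊥ v`, and an ordinary certified row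
  `LowerRow (Model.lincomb 1 λ F S) a b ℓ` ⇒ `CharLowerRow F a b σ p′ (ℓ − λc)` (Rayleigh split of the combined
  file, Courant–Fischer step as in Horn–Johnson Thm 4.2.6, p. 235); `charLowerRow_of_lowerRow_levelShift` — the
  instance `S = Model.diagWeight w μ`, `v = |T_α↑ T_β↓⟩` with the margin hypotheses of `Rows/LevelShiftGapRows`
  (`diagWeight_form_le_on_orth_det`): the SAME shifted-file certificate that yields `GapCertificateCodimOne F a b β`
  there yields `CharLowerRow F a b σ p′ β` here, for every inhabited class `p′` other than the reference's;
* `CharLowerRow.gap_ge`, `CharLowerRow.sub_energy_ge` — the MISSING SIDE: `β − hi ≤ E(class p′) − E(class p)`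
  and `β − hi ≤ E(class p′) − E₀(a, b)` against a class / sector upper row at `hi`.
Honest limit: such a `β` never exceeds the second sector eigenvalue, so the new side is informative when the other
class's lowest state is the first sector excitation (near-degenerate irrep pairs); valid but weak otherwise.
NOT here: any producer, number or claim node; no `GapCertificate*` object is restated, produced or consumed.
-/

namespace Summit.Ventures.CertifiedQuantumChemistry

open Matrix Finset
open Literature.MathematicalPhysics.QuantumLattice Literature.MathematicalPhysics.QuantumChemistry
open scoped ComplexOrder

variable {k m : ℕ} {F : Model k} {a b : ℕ} {σ : Fin m → Finset (Orb (Fin k))} {p p' : Fin m → ℕ}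

/-- **Distinct character classes are orthogonal.** If `v` lies in the class `(σ, p)`, `z` in the class `(σ, p′)`
and the parities differ on some generator `i`, then `⟨v, z⟩ = 0` (no determinant carries both parities).
Mazziotti (2007) §II.F eq. (95) (symmetry blocks do not mix). [cite: Mazziotti2007RDMChapter, §II.F eq. (95)] -/
theorem star_dotProduct_eq_zero_of_mem_charSector {v z : Fock (Orb (Fin k))} (hv : v ∈ charSector σ p)
    (hz : z ∈ charSector σ p') (hne : ∃ i, p i % 2 ≠ p' i % 2) : star v ⬝ᵥ z = 0 := by
  obtain ⟨i, hi⟩ := hne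
  refine Finset.sum_eq_zero fun s _ => ?_
  by_cases hs : (s ∩ σ i).card % 2 = p i % 2
  · rw [(mem_charSector_iff σ p' z).1 hz s ⟨i, by rw [hs]; exact hi⟩, mul_zero]
  · rw [Pi.star_apply, (mem_charSector_iff σ p v).1 hv s ⟨i, hs⟩, star_zero, zero_mul]

/-- **CLASS LOWER ROW FROM A CODIMENSION-ONE FORM BOUND WITH A CLASS-PURE WITNESS.** If
`β · ⟨x, x⟩ ≤ Re ⟨x, H_F x⟩` for every `(a, b)`-sector vector `x` with `⟨v, x⟩ = 0`, `v` lies in the class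
`(σ, p)`, and the class `(σ, p′)` differs from it on some generator and is inhabited in the sector (determinant
`s`), then `CharLowerRow F a b σ p′ β`: every vector of the class `p′` is orthogonal to `v`, so `β` bounds its
Rayleigh quotient, hence the infimum `E(H_F; a, b, class p′)`. No Hermiticity is used. Courant–Fischer step,
Horn–Johnson Thm 4.2.6, p. 235; classes per HJO (4.2.38), p. 115. [cite: HornJohnson2013, Thm 4.2.6, p. 235] -/
theorem charLowerRow_of_forall_orthogonal {β : ℚ} (v : Fock (Orb (Fin k))) (hv : v ∈ charSector σ p)
    (hform : ∀ x : Fock (Orb (Fin k)), IsInSector a b x → star v ⬝ᵥ x = 0 →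
      ((β : ℚ) : ℝ) * (star x ⬝ᵥ x).re ≤ (star x ⬝ᵥ F.hamiltonian *ᵥ x).re)
    (hne : ∃ i, p i % 2 ≠ p' i % 2) {s : Finset (Orb (Fin k))} (ha : (upPart s).card = a)
    (hb : (downPart s).card = b) (hs : IsCharDet σ p' s) : CharLowerRow F a b σ p' β := by
  refine ⟨⟨s, ha, hb, hs⟩, ?_⟩
  rw [Model.charEnergy_def, charSectorGroundEnergy_def]
  refine le_minEnergyOn_of_forall_re_rayleigh _ (szSector_inf_charSector_ne_bot σ p' ha hb hs) ?_
  intro ψ hψ hψ1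
  obtain ⟨hψK, hψχ⟩ := Submodule.mem_inf.1 hψ
  have h := hform ψ ((mem_szSector_iff_isInSector a b ψ).1 hψK)
    (star_dotProduct_eq_zero_of_mem_charSector hv hψχ hne)
  rwa [hψ1, Complex.one_re, mul_one] at h

/-- **Determinant witness.** The same with `v = c |D⟩` for a determinant `D` of the class `(σ, p)` (the
level-shift reference determinant): a form bound `β‖x‖² ≤ Re⟨x, H_F x⟩` on the sector vectors `x` with
`⟨c|D⟩, x⟩ = 0` gives `CharLowerRow F a b σ p′ β` for every other inhabited class. [cite: HornJohnson2013, Thm 4.2.6, p. 235] -/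
theorem charLowerRow_of_forall_orthogonal_single {β : ℚ} {D : Finset (Orb (Fin k))} (hD : IsCharDet σ p D)
    (c : ℂ) (hform : ∀ x : Fock (Orb (Fin k)), IsInSector a b x → star (Pi.single D c : Fock (Orb (Fin k))) ⬝ᵥ x = 0 →
      ((β : ℚ) : ℝ) * (star x ⬝ᵥ x).re ≤ (star x ⬝ᵥ F.hamiltonian *ᵥ x).re)
    (hne : ∃ i, p i % 2 ≠ p' i % 2) {s : Finset (Orb (Fin k))} (ha : (upPart s).card = a)
    (hb : (downPart s).card = b) (hs : IsCharDet σ p' s) : CharLowerRow F a b σ p' β :=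
  charLowerRow_of_forall_orthogonal (Pi.single D c) (single_mem_charSector σ p hD c) hform hne ha hb hs

/-- **CLASS LOWER ROWS FROM LEVEL-SHIFT DATA.** Symmetric models `F`, `S` on the same `k` orbitals, a rational
`λ ≥ 0`, a class-pure vector `v ∈ charSector σ p` with `Re⟨x, Ĥ(S) x⟩ ≤ c‖x‖²` for every `(a, b)`-sector `x ⊥ v`,
and an ordinary certified lower row `ℓ ≤ E₀(Ĥ(F + λS); a, b)` of the combined table file `Model.lincomb 1 λ F S`
give `CharLowerRow F a b σ p′ (ℓ − λc)` for every inhabited class `p′` differing from `p`: on `x ⊥ v`,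
`ℓ‖x‖² ≤ Re⟨x, Ĥ(F)x⟩ + λ Re⟨x, Ĥ(S)x⟩ ≤ Re⟨x, Ĥ(F)x⟩ + λc‖x‖²`. Courant–Fischer step, Horn–Johnson Thm 4.2.6,
p. 235. [cite: HornJohnson2013, Thm 4.2.6, p. 235] -/
theorem charLowerRow_of_lowerRow_shift {S : Model k} (hF : F.IsSymmetric) (hS : S.IsSymmetric) {lam : ℚ}
    (hlam : 0 ≤ lam) (v : Fock (Orb (Fin k))) (hv : v ∈ charSector σ p) {c : ℚ}
    (hSform : ∀ x : Fock (Orb (Fin k)), IsInSector a b x → star v ⬝ᵥ x = 0 →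
      (star x ⬝ᵥ S.hamiltonian *ᵥ x).re ≤ ((c : ℚ) : ℝ) * (star x ⬝ᵥ x).re)
    {ℓ : ℚ} (hL : LowerRow (Model.lincomb 1 lam F S) a b ℓ) (hne : ∃ i, p i % 2 ≠ p' i % 2)
    {s : Finset (Orb (Fin k))} (ha : (upPart s).card = a) (hb : (downPart s).card = b) (hs : IsCharDet σ p' s) :
    CharLowerRow F a b σ p' (ℓ - lam * c) := by
  refine charLowerRow_of_forall_orthogonal v hv (fun x hx hvx => ?_) hne ha hb hs
  have hvar := sectorGroundEnergy_mul_le_re_rayleigh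
    (Model.hamiltonian_isHermitian (Model.lincomb_isSymmetric (α := 1) (β := lam) hF hS)) hx
  have h1 : ((ℓ : ℚ) : ℝ) * (star x ⬝ᵥ x).re ≤ (star x ⬝ᵥ (Model.lincomb 1 lam F S).hamiltonian *ᵥ x).re :=
    (mul_le_mul_of_nonneg_right hL.le (EigenvalueContinuation.re_star_dotProduct_self_nonneg x)).trans hvar
  rw [Model.re_rayleigh_lincomb, Rat.cast_one, one_mul] at h1
  have h2 := mul_le_mul_of_nonneg_left (hSform x hx hvx) (show (0 : ℝ) ≤ lam by exact_mod_cast hlam)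
  push_cast
  nlinarith

/-- **CLASS LOWER ROWS FROM THE LEVEL-SHIFTED FILE OF RECORD** (`S = F_w = Model.diagWeight w μ`, reference
determinant `D⋆ = |T_α↑ T_β↓⟩` winning its occupation pattern by the margin `δ ≥ 0`, as in
`gapCertificateCodimOne_of_lowerRow_levelShift` of `Rows/LevelShiftGapRows`): if `D⋆` lies in the class `(σ, p)`,
then `LowerRow (Model.lincomb 1 λ F F_w) a b ℓ` gives `CharLowerRow F a b σ p′ (ℓ − λ(M − δ − μ))`,
`M = Σ_{T_α} w + Σ_{T_β} w`, for every inhabited class `p′` differing from `p` — one certificate, both the sector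
gap leg (there) and the class-resolved lower rows (here). [cite: HornJohnson2013, Thm 4.2.6, p. 235] -/
theorem charLowerRow_of_lowerRow_levelShift (hF : F.IsSymmetric) {lam : ℚ} (hlam : 0 ≤ lam) {w : Fin k → ℚ}
    {μ : ℚ} {Tα Tβ : Finset (Fin k)} (hTa : Tα.card = a) (hTb : Tβ.card = b) {δ : ℚ} (hδ : 0 ≤ δ)
    (hα : ∀ α : Finset (Fin k), α.card = Tα.card → α ≠ Tα → ∑ q ∈ α, w q + δ ≤ ∑ q ∈ Tα, w q)
    (hβ : ∀ β : Finset (Fin k), β.card = Tβ.card → β ≠ Tβ → ∑ q ∈ β, w q + δ ≤ ∑ q ∈ Tβ, w q)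
    (hD : IsCharDet σ p (pairSet Tα Tβ)) {ℓ : ℚ} (hL : LowerRow (Model.lincomb 1 lam F (Model.diagWeight w μ)) a b ℓ)
    (hne : ∃ i, p i % 2 ≠ p' i % 2) {s : Finset (Orb (Fin k))} (ha : (upPart s).card = a)
    (hb : (downPart s).card = b) (hs : IsCharDet σ p' s) :
    CharLowerRow F a b σ p' (ℓ - lam * (∑ q ∈ Tα, w q + ∑ q ∈ Tβ, w q - δ - μ)) :=
  charLowerRow_of_lowerRow_shift hF (Model.diagWeight_isSymmetric w μ) hlam (Pi.single (pairSet Tα Tβ) (1 : ℂ))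
    (single_mem_charSector σ p hD 1) (diagWeight_form_le_on_orth_det hTa hTb hδ hα hβ) hL hne ha hb hs

/-- **THE MISSING SIDE OF THE IRREP-GAP BRACKET.** A class lower row `β ≤ E(class p′)` and a class upper row
`E(class p) ≤ hi` give `β − hi ≤ E(class p′) − E(class p)`; with `CharUpperRow.gap_le`-type upper sides this
brackets an irrep excitation two-sidedly. Helgaker–Jørgensen–Olsen (2000) §4.2.4, p. 115 (class energies).
[cite: HelgakerJorgensenOlsen2000, eq. (4.2.38), p. 115] -/
theorem CharLowerRow.gap_ge {β hi : ℚ} (hL : CharLowerRow F a b σ p' β) (hU : CharUpperRow F a b σ p hi) :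
    ((β - hi : ℚ) : ℝ) ≤ F.charEnergy a b σ p' - F.charEnergy a b σ p := by
  push_cast
  linarith [hL.le, hU.le]

/-- Against the SECTOR: a class lower row `β ≤ E(class p′)` and a sector upper row `E₀(a, b) ≤ hi` give
`β − hi ≤ E(class p′) − E₀(a, b)`. [cite: HelgakerJorgensenOlsen2000, eq. (4.2.38), p. 115] -/
theorem CharLowerRow.sub_energy_ge {β hi : ℚ} (hL : CharLowerRow F a b σ p' β) (hU : UpperRow F a b hi) :
    ((β - hi : ℚ) : ℝ) ≤ F.charEnergy a b σ p' - F.energy a b := by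
  push_cast
  linarith [hL.le, hU.2.2]

end Summit.Ventures.CertifiedQuantumChemistry
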